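import Summits.QuantumFields.YangMills.Theorems.BalabanUVNodesK0Stub1CriticalEquation143CoordFree
import Summits.QuantumFields.YangMills.Theorems.UnitScaleTiltProp7FlatCoercivityR
import Literature.MathematicalPhysics.QuantumFieldTheory.Balaban1983to89.T4Continuum
import HarnessLib

/-!
# K0⁷ STUB 1 (`stub_prop8StepCoP13`), sub-target S4a file 4: **PRINT's FLAT ONE-LEVEL PROPAGATORS `G = Δ_a⁻¹` ((129); the `G` behind `H` of (45)) AND `G̃ = GP₀*` ((131)∕(143))
# EXIST AT NODE 00's RECORD OBJECTS, WITH `k`-UNIFORM `L²` LETTERS, AND (127) ⟹ (158) HOLDS THERE WITH `hpos` DISCHARGED** — this seat's coordinate-free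
# derivation (`…K0Stub1CriticalEquation143CoordFree`) COMPOSED with the kernel-certified [B5] Prop. 1.1 (1.90) (UST `Prop7FlatCoercivityR`, pub-balaban b05)
# on lit-balaban's V1 operator `Δ_a = ∂*∂ + ∂R∂* + Q*aQ` ([B6] (2.19)) over the fine torus `Site (F.P K) 0` of a 𝕋⁴-family member

Cell `pub-ymgap`, width seat `pub-ymgap-k0-s1-w1` g0 (plan g77 W-SEAT-START-LIST v3 §k0-s1, S4a).  `--kind proof --supports stmt-QuantumFields-20541 --as helper`;
count-neutral.  [15] = [Balaban1985Variational]; [B5] = [Balaban1984PropagatorsI]; [B6] = [Balaban1984PropagatorsII].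

WHY.  File 2 of this seat proves [15] (127) ⟹ (128) ⟹ (143) ⟹ (158) over an ARBITRARY finite-dimensional real inner-product space, from ONE hypothesis:
`hpos` — `Δ_a` positive on the tangent space.  At the record's fine torus, for the FLAT background and ONE averaging level (the structure
`B6SectCTwoScaleV1.twoScale k _ ∅`: all `Ω_i = T`, constraints = the bonds of `T^{(k)}`), that hypothesis is a THEOREM of the tree: UST
`Prop7FlatCoercivityR.inner_deltaAE_twoScale_empty_ge` reads pub-balaban b05's kernel-certified (1.90) (`B5Eq190FlatCoercivityUniform.b05_form_lower`) through
lit-balaban's one-level bridge on `E := BondSpace P = EuclideanSpace ℝ (PBond P 0)` for EVERY `P : Params` with one more level (`k + 1 ≤ m + K`):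
`γ(d,a)·‖x‖² ≤ ⟨x, Δ_a x⟩`, `γ(d,a) = 1∕((d+1)·Cst d a)`, `Δ_a = B6SectAVectorModelV1.deltaAE (twoScale k _ ∅) (L^k) w`, weight `w ≡ a·L^{kd}`.  THIS FILE
instantiates it at `P := F.P K` of a `T4Family` member (`d = 4`: `γ = 1∕(5·Cst 4 a)`) and composes: (i) `Δ_a` is positive definite on ALL of `E`, so print's
`G = Δ_a⁻¹` of (129) EXISTS as a linear operator with `‖Gw‖ ≤ 5·Cst 4 a·‖w‖` (file 2's restricted solution operator at `T = ⊤`); (ii) for EVERY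
tangent subspace `T ≤ E` print's `G̃` ((131) «P₀ = I − GQ*(QGQ*)⁻¹Q», (143) «GP₀* = G̃») EXISTS: linear, values in `T`, `⟨δ, Δ_a(G̃w)⟩ = ⟨δ, w⟩` on `T`,
unique, `‖G̃w‖ ≤ 5·Cst 4 a·‖w‖`; (iii) hence file 2's `exists_Gt_eq158_of_critical128` holds at the record with `hpos` DISCHARGED: for every linear
constraint `Q` and right inverse `H` with `Δ_a`-range orthogonal to `ker Q`, every (128)-critical `A′` has its tangent component `A₁ = A′ − H(QA′)` solving
*«A₁ + G̃((δ∕δA′)V)(A₁ + HB) = 0. (158)»*.  A6: this is the CONTENTFUL inhabitant of file 2's hypothesis block at the record (the RECORD's flat `Δ_a`).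

WHAT IS PROVED (sorry-free; no definition; axioms standard).
* §1 `one_le_Cst`, `inner_deltaAE_ge_T4` ((1.90) at `Site (F.P K) 0`, `k + 1 ≤ m + K`), `deltaAE_pos_T4` (`x ≠ 0 ⇒ 0 < ⟨x, Δ_a x⟩`).
* §2 ★ `exists_flatG_L2_T4` — `G = Δ_a⁻¹` EXISTS: ℝ-linear, `Δ_a (G w) = w`, `G (Δ_a x) = x`, `‖G w‖ ≤ 5·Cst 4 a·‖w‖`.
* §3 ★ `exists_flatGt_L2_T4` — for every submodule `T`: `G̃` EXISTS (linear, values in `T`, restricted solution, unique), `‖G̃ w‖ ≤ 5·Cst 4 a·‖w‖`.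
* §4 ★ `exists_Gt_eq158_flat_T4` — (127) ⟹ (158) AT THE RECORD, flat, one level, `hpos` discharged.
HONEST SCOPE.  (i) ONE level, whole torus, FLAT background, `L²` letters: print's sup-norm ∕ decay letters `B₀` of (161)–(163) (the `hG` of this seat's file 1 =
[B6] Props. 2.2–2.7 ∕ Cor. 2.8 at d = 4 — the port bridge) are NOT here; the multi-level cube sequence (144) with boundary conditions and the small-field
`Δ_a(U₀)` ([B9] Thm 3.11 proper) are NOT here (file 3 has the covariant `L²` core without `R`).  (ii) `Δ_a` is lit-balaban's V1 operator with print's residual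
projection `R` ([B5] (1.70)–(1.72)); the junction with S1's `Δ^η(1)` on 𝔰𝔲(2)-valued fields (dag-n07-w1 `Node00/HessianOperatorAtBackground`) is S1's —
componentwise by UST `FlatScalarExtension`.  (iii) Nothing of [15]'s analysis asserted; `stub_prop8StepCoP13` ∕ K0⁷ NOT closed; N07 NOT discharged; counts
unmoved (28∕28 · 5∕27); one finite 𝕋⁴ programme at fixed ε — R4 closes the conditional finite-𝕋⁴ rung `BalabanLadder.UV` only, never the summit; the YM
mass gap (Clay) is NOT proved by any of this; nothing continuum ∕ ℝ⁴ ∕ OS.  No `sorry`, no `def`, no `instance`, no `notation`.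

References: [15] (45)–(46) p.285 ((45) = `H`'s defining constraints, (46) = the BOUNDS `|HB| ≤ B₀(L^jη)⁻¹|B|`), (127)–(133) pp.297–298 ((129): `H₀ = GQ*(QGQ*)⁻¹`, `G = Δ_a⁻¹`), (143) p.300, (158) p.302; [B5] Prop. 1.1 (1.89)–(1.90) p.33, (1.69)–(1.72) pp.29–30;
[B6] (2.17)–(2.19) p.226, (2.90) p.239; [Balaban1987RG1] (0.1) p.251.

v1.1 (g2, 2026-08-28; DOCSTRINGS ONLY — every declaration, statement and proof byte-identical to v1 p587257): ref-O g2 READ-42 NITs — LOCATED-1: [15] p.285's (46) is the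
BOUND on `HB`, (45) the defining constraints of `H`; the formulas «`H₀ = GQ*(QGQ*)⁻¹`, `G = Δ_a⁻¹`» are (129) p.297 — attributions corrected above; `exists_flatG_L2_T4` uses the
NONDEGENERACY of `⟪·,·⟫` (stated); `succ_le_m_add_K` is bookkeeping (`rfl` on the record's `Params`).
-/

set_option autoImplicit false

noncomputable section

open scoped BigOperators InnerProductSpace RealInnerProductSpace

namespace Summit.QuantumFields.YangMills.Theorems.K0Stub1FlatPropagatorsExistAtRecord

open Literature.MathematicalPhysics.QuantumFieldTheory.Balaban1983to89
open Literature.MathematicalPhysics.QuantumFieldTheory.Balaban1983to89.T4Continuum (T4Family)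
open B6SectADomainsV1 B6SectAOperatorsV1 B6SectAVectorModelV1 B6SectCTwoScaleV1
open Literature.MathematicalPhysics.QuantumFieldTheory.BalabanImbrieJaffe1984to88.BIJ85AxialPropagator411 (BondSpace)
open Summit.QuantumFields.YangMills.Theorems.Prop7FlatCoercivityR (inner_deltaAE_twoScale_empty_ge)
open Summit.QuantumFields.YangMills.Theorems.K0Stub1CriticalEquation143CoordFree (exists_restrictedSolutionOp restricted_solution_unique
  eq158_of_critical128)

/-! ## §1  [B5] Prop. 1.1 (1.90) at the record's fine torus: `Δ_a` is positive definite, `k`-uniformly -/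

/-- `1 ≤ Cst d a` (b05's constant `Cst d a = max γ₀ (max a⁻¹ 1)`), hence `0 < Cst d a`. [cite: Balaban1984PropagatorsI, Prop. 1.1 (1.90) p.33 (bookkeeping)] -/
theorem one_le_Cst (d : ℕ) (a : ℝ) : 1 ≤ B5Prop11Plancherel.Cst d a :=
  le_max_of_le_right (le_max_right _ _)

/-- One more level above the fine torus on the record's `Params`: `k + 1 ≤ F.m + K` is `k + 1 ≤ (F.P K).m + (F.P K).K` (bookkeeping; `(F.P K).m = F.m`, `(F.P K).K = K` by `rfl`). [folklore] -/
theorem succ_le_m_add_K (F : T4Family) (K k : ℕ) (hk1 : k + 1 ≤ F.m + K) : k + 1 ≤ (F.P K).m + (F.P K).K := hk1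

/-- **[B5] PROP. 1.1 (1.90) AT THE RECORD's FINE TORUS** (`BondSpace (F.P K) = EuclideanSpace ℝ (PBond (F.P K) 0)`, one-level structure `twoScale k _ ∅`, lattice
factor `L^k`, weight `a·L^{4k}` on the constraints, `k + 1 ≤ m + K`): `(1∕(5·Cst 4 a))·‖x‖² ≤ ⟨x, Δ_a x⟩` for every real bond field `x`, with
`Δ_a = deltaAE (twoScale k _ ∅) (L^k) w = ∂*∂ + ∂R∂* + Q*aQ` ([B6] (2.19) = [B5] (1.69)) — uniform in `m`, `K`, `k`.  UST `Prop7FlatCoercivityR.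
inner_deltaAE_twoScale_empty_ge` at `P := F.P K` (`(F.P K).d = 4` by `rfl`). [cite: Balaban1984PropagatorsI, Prop. 1.1 (1.90) p.33; Balaban1984PropagatorsII, (2.19) p.226] -/
theorem inner_deltaAE_ge_T4 (F : T4Family) (K k : ℕ) (hk1 : k + 1 ≤ F.m + K) {a : ℝ} (ha : 0 < a)
    {w : BondIdx (twoScale k (succ_le_m_add_K F K k hk1) (∅ : Finset (Site (F.P K) (k + 1)))) → ℝ}
    (hwa : ∀ p, w p = a * ((F.L : ℝ) ^ k) ^ 4) (x : BondSpace (F.P K)) :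
    (1 / (5 * B5Prop11Plancherel.Cst 4 a)) * ‖x‖ ^ 2
      ≤ ⟪x, deltaAE (twoScale k (succ_le_m_add_K F K k hk1) ∅) ((F.L : ℝ) ^ k) w x⟫_ℝ := by
  have h := inner_deltaAE_twoScale_empty_ge (P := F.P K) (succ_le_m_add_K F K k hk1) ha (w := w) (fun p => by rw [hwa p]; rfl) x
  have hd : ((F.P K).d : ℝ) = 4 := by norm_num [T4Family.P_d]
  rw [hd] at h
  norm_num at h ⊢
  exact h

/-- **`Δ_a` IS POSITIVE DEFINITE AT THE RECORD** (flat, one level): `x ≠ 0 ⇒ 0 < ⟨x, Δ_a x⟩` — the hypothesis `hpos` of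
`K0Stub1CriticalEquation143CoordFree` on ALL of `BondSpace (F.P K)`, hence on every tangent subspace. [cite: Balaban1984PropagatorsI, Prop. 1.1 (1.90) p.33] -/
theorem deltaAE_pos_T4 (F : T4Family) (K k : ℕ) (hk1 : k + 1 ≤ F.m + K) {a : ℝ} (ha : 0 < a)
    {w : BondIdx (twoScale k (succ_le_m_add_K F K k hk1) (∅ : Finset (Site (F.P K) (k + 1)))) → ℝ}
    (hwa : ∀ p, w p = a * ((F.L : ℝ) ^ k) ^ 4) (x : BondSpace (F.P K)) (hx : x ≠ 0) :
    0 < ⟪x, deltaAE (twoScale k (succ_le_m_add_K F K k hk1) ∅) ((F.L : ℝ) ^ k) w x⟫_ℝ := by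
  have h := inner_deltaAE_ge_T4 F K k hk1 ha hwa x
  have hC : 0 < 5 * B5Prop11Plancherel.Cst 4 a := by linarith [one_le_Cst 4 a]
  have hx2 : 0 < ‖x‖ ^ 2 := by positivity
  exact lt_of_lt_of_le (mul_pos (one_div_pos.2 hC) hx2) h

/-- The `L²` letter of a restricted solution: if `z ∈ T` solves `⟨δ, Δ_a z⟩ = ⟨δ, w⟩` on `T` then `‖z‖ ≤ 5·Cst 4 a·‖w‖` (take `δ = z`: `γ‖z‖² ≤ ⟨z, Δ_az⟩ = ⟨z, w⟩ ≤
‖z‖‖w‖`) — the `L²` analogue of print's letter (46). [cite: Balaban1984PropagatorsI, Prop. 1.1 (1.90) p.33; Balaban1985Variational, (46) p.285] -/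
theorem norm_restricted_solution_le_T4 (F : T4Family) (K k : ℕ) (hk1 : k + 1 ≤ F.m + K) {a : ℝ} (ha : 0 < a)
    {w : BondIdx (twoScale k (succ_le_m_add_K F K k hk1) (∅ : Finset (Site (F.P K) (k + 1)))) → ℝ}
    (hwa : ∀ p, w p = a * ((F.L : ℝ) ^ k) ^ 4) (T : Submodule ℝ (BondSpace (F.P K))) {z v : BondSpace (F.P K)} (hz : z ∈ T)
    (hsol : ∀ δ ∈ T, ⟪δ, deltaAE (twoScale k (succ_le_m_add_K F K k hk1) ∅) ((F.L : ℝ) ^ k) w z⟫_ℝ = ⟪δ, v⟫_ℝ) :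
    ‖z‖ ≤ 5 * B5Prop11Plancherel.Cst 4 a * ‖v‖ := by
  have hC : 0 < 5 * B5Prop11Plancherel.Cst 4 a := by linarith [one_le_Cst 4 a]
  have h := inner_deltaAE_ge_T4 F K k hk1 ha hwa z
  rw [hsol z hz] at h
  have hcs : ⟪z, v⟫_ℝ ≤ ‖z‖ * ‖v‖ := real_inner_le_norm _ _
  by_cases hz0 : ‖z‖ = 0
  · rw [hz0]; positivity
  · have hzpos : 0 < ‖z‖ := lt_of_le_of_ne (norm_nonneg _) (Ne.symm hz0)
    -- (1/C)‖z‖² ≤ ‖z‖‖v‖ ⇒ ‖z‖ ≤ C‖v‖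
    have h1 : (1 / (5 * B5Prop11Plancherel.Cst 4 a)) * ‖z‖ ^ 2 ≤ ‖z‖ * ‖v‖ := h.trans hcs
    have h2 : ‖z‖ ^ 2 ≤ (5 * B5Prop11Plancherel.Cst 4 a) * (‖z‖ * ‖v‖) := by
      have := mul_le_mul_of_nonneg_left h1 hC.le
      rwa [← mul_assoc, mul_one_div_cancel hC.ne', one_mul] at this
    nlinarith [h2, hzpos, norm_nonneg v]

/-! ## §2  ★ Print's `G = Δ_a⁻¹` exists at the record (flat, one level) -/

/-- ★ **PRINT's `G = Δ_a⁻¹` ((129) p.297 «H₀ = GQ*(QGQ*)⁻¹ … where G = Δ_a⁻¹»; the minimiser `H` of (45) p.285; [B6] (2.90)) EXISTS AT THE RECORD's FINE TORUS, FLAT, ONE LEVEL, WITH A `k`-UNIFORM `L²`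
LETTER**: there is an ℝ-linear `G` on `BondSpace (F.P K)` with `Δ_a(Gw) = w`, `G(Δ_a x) = x` and `‖Gw‖ ≤ 5·Cst 4 a·‖w‖` — file 2's restricted solution operator on
`T = ⊤` (positivity on all of `E` by (1.90)) plus NONDEGENERACY of the inner product (not symmetry). [cite: Balaban1985Variational, (129) p.297, (45) p.285; Balaban1984PropagatorsII, (2.90) p.239; Balaban1984PropagatorsI, Prop. 1.1 (1.90) p.33] -/
theorem exists_flatG_L2_T4 (F : T4Family) (K k : ℕ) (hk1 : k + 1 ≤ F.m + K) {a : ℝ} (ha : 0 < a)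
    {w : BondIdx (twoScale k (succ_le_m_add_K F K k hk1) (∅ : Finset (Site (F.P K) (k + 1)))) → ℝ}
    (hwa : ∀ p, w p = a * ((F.L : ℝ) ^ k) ^ 4) :
    ∃ G : BondSpace (F.P K) →ₗ[ℝ] BondSpace (F.P K),
      (∀ v, deltaAE (twoScale k (succ_le_m_add_K F K k hk1) ∅) ((F.L : ℝ) ^ k) w (G v) = v) ∧
      (∀ x, G (deltaAE (twoScale k (succ_le_m_add_K F K k hk1) ∅) ((F.L : ℝ) ^ k) w x) = x) ∧
      ∀ v, ‖G v‖ ≤ 5 * B5Prop11Plancherel.Cst 4 a * ‖v‖ := by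
  set Δ := deltaAE (twoScale k (succ_le_m_add_K F K k hk1) ∅) ((F.L : ℝ) ^ k) w with hΔ
  have hpos : ∀ z ∈ (⊤ : Submodule ℝ (BondSpace (F.P K))), z ≠ 0 → 0 < ⟪z, Δ z⟫_ℝ :=
    fun z _ hz => deltaAE_pos_T4 F K k hk1 ha hwa z hz
  obtain ⟨G, hG, huniq⟩ := exists_restrictedSolutionOp (⊤ : Submodule ℝ (BondSpace (F.P K))) Δ hpos
  refine ⟨G, fun v => ?_, fun x => ?_, fun v => ?_⟩
  · exact ext_inner_left ℝ fun δ => (hG v).2 δ Submodule.mem_top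
  · exact (huniq (Δ x) x Submodule.mem_top fun δ _ => rfl).symm
  · exact norm_restricted_solution_le_T4 F K k hk1 ha hwa ⊤ (hG v).1 (hG v).2

/-! ## §3  ★ Print's `G̃ = GP₀*` exists at the record on every tangent subspace -/

/-- ★ **PRINT's RESTRICTED PROPAGATOR `G̃` ((131) `P₀ = I − GQ*(QGQ*)⁻¹Q`, (143) «GP₀* = G̃») EXISTS AT THE RECORD's FINE TORUS, FLAT, ONE LEVEL, FOR EVERY
TANGENT SUBSPACE `T`** (print: `T = {QA′ = 0}` ∕ `{QδA′ = 0, RD*δA′ = 0}`): an ℝ-linear `G̃` with values in `T`, `⟨δ, Δ_a(G̃v)⟩ = ⟨δ, v⟩` for all `δ ∈ T`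
(the solution operator of `½⟨A′, Δ_aA′⟩` restricted to `T`), UNIQUE among `T`-valued solutions, with the `k`-uniform `L²` letter `‖G̃v‖ ≤ 5·Cst 4 a·‖v‖`.
[cite: Balaban1985Variational, (131) p.298, (143) p.300; Balaban1984PropagatorsI, Prop. 1.1 (1.90) p.33] -/
theorem exists_flatGt_L2_T4 (F : T4Family) (K k : ℕ) (hk1 : k + 1 ≤ F.m + K) {a : ℝ} (ha : 0 < a)
    {w : BondIdx (twoScale k (succ_le_m_add_K F K k hk1) (∅ : Finset (Site (F.P K) (k + 1)))) → ℝ}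
    (hwa : ∀ p, w p = a * ((F.L : ℝ) ^ k) ^ 4) (T : Submodule ℝ (BondSpace (F.P K))) :
    ∃ Gt : BondSpace (F.P K) →ₗ[ℝ] BondSpace (F.P K),
      (∀ v, Gt v ∈ T ∧ ∀ δ ∈ T, ⟪δ, deltaAE (twoScale k (succ_le_m_add_K F K k hk1) ∅) ((F.L : ℝ) ^ k) w (Gt v)⟫_ℝ = ⟪δ, v⟫_ℝ) ∧
      (∀ (v z : BondSpace (F.P K)), z ∈ T →
        (∀ δ ∈ T, ⟪δ, deltaAE (twoScale k (succ_le_m_add_K F K k hk1) ∅) ((F.L : ℝ) ^ k) w z⟫_ℝ = ⟪δ, v⟫_ℝ) → z = Gt v) ∧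
      ∀ v, ‖Gt v‖ ≤ 5 * B5Prop11Plancherel.Cst 4 a * ‖v‖ := by
  set Δ := deltaAE (twoScale k (succ_le_m_add_K F K k hk1) ∅) ((F.L : ℝ) ^ k) w with hΔ
  have hpos : ∀ z ∈ T, z ≠ 0 → 0 < ⟪z, Δ z⟫_ℝ := fun z _ hz => deltaAE_pos_T4 F K k hk1 ha hwa z hz
  obtain ⟨G, hG, huniq⟩ := exists_restrictedSolutionOp T Δ hpos
  exact ⟨G, hG, huniq, fun v => norm_restricted_solution_le_T4 F K k hk1 ha hwa T (hG v).1 (hG v).2⟩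

/-! ## §4  ★ (127) ⟹ (158) at the record, flat, one level — `hpos` discharged -/

variable {F' : Type*} [AddCommGroup F'] [Module ℝ F']

/-- ★ **[15] (127) ⟹ (158) AT THE RECORD's FINE TORUS, FLAT BACKGROUND, ONE LEVEL, WITH `hpos` DISCHARGED BY (1.90)**: for `Δ_a = deltaAE (twoScale k _ ∅) (L^k) w`
(`w ≡ a·L^{4k}`, `k + 1 ≤ m + K`), every linear constraint map `Q : BondSpace (F.P K) → F′` (print: the linearised `k`-fold (0.4) averaging, S2) and every right
inverse `H` of `Q` whose range is `Δ_a`-orthogonal to `ker Q` (print's `H₀` (129) or Sect. F's `H`): there is an ℝ-linear `G̃` with values in `ker Q` (the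
restricted propagator) such that EVERY `A′` critical in the sense (128) — `⟨δ, Δ_aA′ + W(A′)⟩ = 0` for all `δ ∈ ker Q`, ANY map `W` (print: `(δ∕δA′)V`) — has its
tangent component solving *«A₁ + G̃((δ∕δA′)V)(A₁ + HB) = 0 (158)»* with `A₁ = A′ − H(QA′)`, `HB = H(QA′)`.  File 2's `exists_Gt_eq158_of_critical128` with its only
analytic hypothesis supplied by `deltaAE_pos_T4`. [cite: Balaban1985Variational, (127)–(133) pp.297–298, (143) p.300, (158) p.302; Balaban1984PropagatorsI, Prop. 1.1 (1.90) p.33] -/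
theorem exists_Gt_eq158_flat_T4 (F : T4Family) (K k : ℕ) (hk1 : k + 1 ≤ F.m + K) {a : ℝ} (ha : 0 < a)
    {w : BondIdx (twoScale k (succ_le_m_add_K F K k hk1) (∅ : Finset (Site (F.P K) (k + 1)))) → ℝ}
    (hwa : ∀ p, w p = a * ((F.L : ℝ) ^ k) ^ 4) (Q : BondSpace (F.P K) →ₗ[ℝ] F') (H : F' →ₗ[ℝ] BondSpace (F.P K))
    (hQH : ∀ B, Q (H B) = B)
    (hHorth : ∀ δ ∈ LinearMap.ker Q, ∀ B, ⟪δ, deltaAE (twoScale k (succ_le_m_add_K F K k hk1) ∅) ((F.L : ℝ) ^ k) w (H B)⟫_ℝ = 0) :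
    ∃ Gt : BondSpace (F.P K) →ₗ[ℝ] BondSpace (F.P K),
      (∀ v, Gt v ∈ LinearMap.ker Q ∧
        ∀ δ ∈ LinearMap.ker Q, ⟪δ, deltaAE (twoScale k (succ_le_m_add_K F K k hk1) ∅) ((F.L : ℝ) ^ k) w (Gt v)⟫_ℝ = ⟪δ, v⟫_ℝ) ∧
      ∀ (W : BondSpace (F.P K) → BondSpace (F.P K)) (A' : BondSpace (F.P K)),
        (∀ δ ∈ LinearMap.ker Q, ⟪δ, deltaAE (twoScale k (succ_le_m_add_K F K k hk1) ∅) ((F.L : ℝ) ^ k) w A' + W A'⟫_ℝ = 0) →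
          (A' - H (Q A')) + Gt (W ((A' - H (Q A')) + H (Q A'))) = 0 := by
  set Δ := deltaAE (twoScale k (succ_le_m_add_K F K k hk1) ∅) ((F.L : ℝ) ^ k) w with hΔ
  have hpos : ∀ z ∈ LinearMap.ker Q, z ≠ 0 → 0 < ⟪z, Δ z⟫_ℝ := fun z _ hz => deltaAE_pos_T4 F K k hk1 ha hwa z hz
  obtain ⟨G, hG, -⟩ := exists_restrictedSolutionOp (LinearMap.ker Q) Δ hpos
  exact ⟨G, hG, fun W A' h128 => eq158_of_critical128 Δ Q hpos G hG H hQH hHorth W h128⟩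

end Summit.QuantumFields.YangMills.Theorems.K0Stub1FlatPropagatorsExistAtRecord

end
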